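import Literature.MathematicalPhysics.QuantumLattice.GibbsTwoTimeBound
import Literature.MathematicalPhysics.QuantumLattice.HubbardSchwingerFunction
import Literature.MathematicalPhysics.QuantumLattice.HubbardGaugeBound
import Mathlib.Analysis.Complex.RealDeriv
import Mathlib.Analysis.Calculus.MeanValue
import HarnessLib

/-!
# Boundedness of the finite-temperature Schwinger functions (companion to `GibbsTwoTimeBound`)

Topic `MathematicalPhysics/QuantumLattice`; programme under the tree's fact `bgm_two_point_limit`.
The two-time Gibbs bound `|Tr(e^{-(β-τ)H} A e^{-τH} B)| ≤ ‖A‖‖B‖ Tr e^{-βH}` of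
`GibbsTwoTimeBound.lean` applied to the objects of `HubbardSchwingerFunction.lean`:
`|⟨A(τ)B⟩_β| ≤ ‖A‖‖B‖` for `0 ≤ τ ≤ β` (`norm_gibbsState_imagTimeEvolve_mul_le`), the time-ordered
two-point function `|⟨T A(x₀)B(y₀)⟩_β| ≤ ‖A‖‖B‖` for `|x₀ - y₀| ≤ β` (`norm_schwingerTwoPoint_le`), and
BGM's two-point Schwinger function of the 2D Hubbard torus, `|S^{β,L}(𝐱,σ,-;𝐲,σ',+)| ≤ 1` for
`|x₀ - y₀| ≤ β`, all `U, μ, L` (`norm_hubbardSchwingerTwoPoint_le_one`; `‖c‖, ‖c†‖ ≤ 1` from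
`HubbardGaugeBound.lean`) — the volume-uniform a-priori bound on the object of BGM's Theorem 1.1
(Ann. Henri Poincaré 7 (2006) 809, §1.2 (1.2)–(1.3)) — and, by Bolzano–Weierstrass, the existence
of subsequential thermodynamic limits of `S^{β,L}` at fixed times
(`exists_tendsto_subseq_hubbardSchwingerTwoPoint`; uniqueness of the limit is BGM's theorem and is
not claimed). Also: `τ ↦ ⟨A(τ)B⟩_β` is holomorphic/differentiable with derivative `⟨[H,A](τ)B⟩_β`
(`Matrix.hasDerivAt_gibbsState_imagTimeEvolve_mul(_complex)`), hence Lipschitz on `[0, β]` with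
constant `‖HA - AH‖‖B‖` (`norm_gibbsState_imagTimeEvolve_mul_sub_le_of_isHermitian`) — the
volume enters only through the commutator of `A` with `H` (equicontinuity in the time).
Everything is PROVED; no definition.

## References

* G. Benfatto, A. Giuliani, V. Mastropietro, Ann. Henri Poincaré 7 (2006) 809–898, §1.2
  (1.2)–(1.3). [BenfattoGiulianiMastropietro2006]
* O. Bratteli, D. W. Robinson, *Operator Algebras and Quantum Statistical Mechanics II*, 2nd ed.
  (Springer 1997), §5.3.1 (boundedness of KMS correlation functions on the closed strip).
  [BratteliRobinsonII1997]
-/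

noncomputable section

open scoped Matrix.Norms.L2Operator ComplexOrder
open Matrix Finset NormedSpace

namespace Literature.MathematicalPhysics.QuantumLattice

variable {n : Type*} [Fintype n] [DecidableEq n]

section Schwinger

variable {H : Matrix n n ℂ}

/-- The same with the imaginary-time evolution of `HubbardSchwingerFunction.lean`:
`|⟨A(τ) B⟩_β| ≤ ‖A‖ ‖B‖` for `0 ≤ τ ≤ β`. Bratteli–Robinson II §5.3.1. [folklore] -/
theorem norm_gibbsState_imagTimeEvolve_mul_le (hH : H.IsHermitian) [Nonempty n] {β τ : ℝ}
    (h0 : 0 ≤ τ) (h1 : τ ≤ β) (A B : Matrix n n ℂ) :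
    ‖gibbsState β H (Matrix.imagTimeEvolve H (τ : ℂ) A * B)‖ ≤ ‖A‖ * ‖B‖ := by
  rw [Matrix.imagTimeEvolve]
  exact norm_gibbsState_exp_mul_mul_exp_neg_mul_le hH h0 h1 A B

/-- **The time-ordered two-point function is bounded by the operator norms on one period**:
`|⟨T A(x₀) B(y₀)⟩_β| ≤ ‖A‖ ‖B‖` for `|x₀ - y₀| ≤ β` and Hermitian `H` — in particular BGM's
Schwinger functions (2006, §1.2) are bounded by `1` in every finite volume, uniformly in the
volume (the input for compactness in `L`). [folklore] -/
theorem norm_schwingerTwoPoint_le (hH : H.IsHermitian) [Nonempty n] (A B : Matrix n n ℂ)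
    {β x₀ y₀ : ℝ} (h : |x₀ - y₀| ≤ β) :
    ‖Matrix.schwingerTwoPoint β H A B x₀ y₀‖ ≤ ‖A‖ * ‖B‖ := by
  by_cases hlt : y₀ < x₀
  · rw [Matrix.schwingerTwoPoint_of_lt _ _ _ _ hlt, Matrix.gibbsState_imagTimeEvolve_mul_imagTimeEvolve,
      ← Complex.ofReal_sub]
    exact norm_gibbsState_imagTimeEvolve_mul_le hH (sub_pos.mpr hlt).le (abs_le.mp h).2 A B
  · rw [Matrix.schwingerTwoPoint_of_le _ _ _ _ (not_lt.mp hlt), norm_neg,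
      Matrix.gibbsState_imagTimeEvolve_mul_imagTimeEvolve, ← Complex.ofReal_sub, mul_comm ‖A‖]
    rw [abs_sub_comm] at h
    exact norm_gibbsState_imagTimeEvolve_mul_le hH (sub_nonneg.mpr (not_lt.mp hlt)) (abs_le.mp h).2 B A

end Schwinger

end Literature.MathematicalPhysics.QuantumLattice

/-! ### Time derivative and Lipschitz continuity of two-time correlations -/

namespace Matrix

variable {n : Type*} [Fintype n] [DecidableEq n]

/-- **Two-time correlations are holomorphic in the complex time with derivative the correlation
of the evolved commutator**: `d/ds ⟨A(s) B⟩_β = ⟨[H,A](s) B⟩_β`, `A(s) = e^{sH}Ae^{-sH}`,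
`[H,A] = HA - AH` (`d/ds e^{sH}Ae^{-sH} = e^{sH}[H,A]e^{-sH}`, then linearity of the state).
Bratteli–Robinson II §5.3.1 (`δ = [H,·]` generates the dynamics). [folklore] -/
theorem hasDerivAt_gibbsState_imagTimeEvolve_mul_complex (β : ℝ) (H A B : Matrix n n ℂ) (s : ℂ) :
    HasDerivAt (fun u : ℂ => gibbsState β H (imagTimeEvolve H u A * B))
      (gibbsState β H (imagTimeEvolve H s (H * A - A * H) * B)) s := by
  -- the operator-valued derivative
  have h1 : HasDerivAt (fun u : ℂ => exp (u • H)) (H * exp (s • H)) s := hasDerivAt_exp_smul_const' H s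
  have h2 : HasDerivAt (fun u : ℂ => exp (-(u • H))) (exp (-(s • H)) * (-H)) s := by
    have := hasDerivAt_exp_smul_const (-H) s
    simp only [smul_neg] at this
    exact this
  have h12 := (h1.mul_const A).mul h2
  have hc1 : H * exp (s • H) = exp (s • H) * H := (((Commute.refl H).smul_right s).exp_right).eq
  have hc2 : exp (-(s • H)) * H = H * exp (-(s • H)) :=
    ((((Commute.refl H).smul_right s).neg_right).exp_right).eq.symm
  have halg : H * exp (s • H) * A * exp (-(s • H)) + exp (s • H) * A * (exp (-(s • H)) * -H) =
      imagTimeEvolve H s (H * A - A * H) := by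
    rw [imagTimeEvolve_eq, hc1, show exp (s • H) * A * (exp (-(s • H)) * -H) =
      -(exp (s • H) * A * (exp (-(s • H)) * H)) by noncomm_ring, hc2]
    noncomm_ring
  -- compose with the (ℂ-linear) functional `X ↦ ⟨X B⟩_β`
  set L : Matrix n n ℂ →L[ℂ] ℂ :=
    LinearMap.toContinuousLinearMap ((gibbsState β H) ∘ₗ (LinearMap.mulRight ℂ B)) with hL
  have hLapply : ∀ X : Matrix n n ℂ, L X = gibbsState β H (X * B) := fun X => rfl
  have h := L.hasFDerivAt.comp_hasDerivAt s h12
  rw [halg] at h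
  have hfun : (fun u : ℂ => gibbsState β H (imagTimeEvolve H u A * B)) =
      (L : Matrix n n ℂ → ℂ) ∘ fun u : ℂ => exp (u • H) * A * exp (-(u • H)) := by
    funext u
    simp only [Function.comp_apply, hLapply, imagTimeEvolve_eq]
  rw [hfun]
  exact h

/-- The same along REAL times `τ ↦ ⟨A(τ) B⟩_β`. [folklore] -/
theorem hasDerivAt_gibbsState_imagTimeEvolve_mul (β : ℝ) (H A B : Matrix n n ℂ) (τ : ℝ) :
    HasDerivAt (fun t : ℝ => gibbsState β H (imagTimeEvolve H (t : ℂ) A * B))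
      (gibbsState β H (imagTimeEvolve H (τ : ℂ) (H * A - A * H) * B)) τ :=
  (hasDerivAt_gibbsState_imagTimeEvolve_mul_complex β H A B (τ : ℂ)).comp_ofReal

/-- **Two-time correlations are continuous in the time.** [folklore] -/
theorem continuous_gibbsState_imagTimeEvolve_mul (β : ℝ) (H A B : Matrix n n ℂ) :
    Continuous fun t : ℝ => gibbsState β H (imagTimeEvolve H (t : ℂ) A * B) :=
  continuous_iff_continuousAt.mpr fun τ =>
    (hasDerivAt_gibbsState_imagTimeEvolve_mul β H A B τ).continuousAt

/-- **Lipschitz continuity in time from a bound on the derivative correlation** (mean value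
inequality): if `‖⟨[H,A](t) B⟩_β‖ ≤ K` for `t ∈ [a, b]` then `‖⟨A(b)B⟩_β - ⟨A(a)B⟩_β‖ ≤ K (b - a)`.
With the two-time Gibbs bound one may take `K = ‖HA - AH‖ ‖B‖` on `[0, β]`. [folklore] -/
theorem norm_gibbsState_imagTimeEvolve_mul_sub_le (β : ℝ) (H A B : Matrix n n ℂ) {K a b : ℝ}
    (hab : a ≤ b)
    (hK : ∀ t ∈ Set.Icc a b, ‖gibbsState β H (imagTimeEvolve H (t : ℂ) (H * A - A * H) * B)‖ ≤ K) :
    ‖gibbsState β H (imagTimeEvolve H (b : ℂ) A * B) - gibbsState β H (imagTimeEvolve H (a : ℂ) A * B)‖ ≤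
      K * (b - a) :=
  norm_image_sub_le_of_norm_deriv_le_segment' (f := fun t : ℝ => gibbsState β H (imagTimeEvolve H (t : ℂ) A * B))
    (fun t _ => (hasDerivAt_gibbsState_imagTimeEvolve_mul β H A B t).hasDerivWithinAt)
    (fun t ht => hK t (Set.Ico_subset_Icc_self ht)) b (Set.right_mem_Icc.mpr hab)

end Matrix

namespace Literature.MathematicalPhysics.QuantumLattice

section Lipschitz

variable {n : Type*} [Fintype n] [DecidableEq n] {H : Matrix n n ℂ}

/-- **Equi-Lipschitz continuity of two-time correlations in the time**: for Hermitian `H`,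
`0 ≤ a ≤ b ≤ β` and all `A`, `B`,
`‖⟨A(b)B⟩_β - ⟨A(a)B⟩_β‖ ≤ ‖HA - AH‖ ‖B‖ (b - a)` — the Lipschitz constant involves only the
commutator of `A` with the Hamiltonian (for a local observable of a lattice system: only the
terms of `H` near the support of `A`), not the volume. [folklore] -/
theorem norm_gibbsState_imagTimeEvolve_mul_sub_le_of_isHermitian (hH : H.IsHermitian) [Nonempty n]
    {β a b : ℝ} (h0 : 0 ≤ a) (hab : a ≤ b) (hb : b ≤ β) (A B : Matrix n n ℂ) :
    ‖Matrix.gibbsState β H (Matrix.imagTimeEvolve H (b : ℂ) A * B) -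
        Matrix.gibbsState β H (Matrix.imagTimeEvolve H (a : ℂ) A * B)‖ ≤
      ‖H * A - A * H‖ * ‖B‖ * (b - a) :=
  Matrix.norm_gibbsState_imagTimeEvolve_mul_sub_le β H A B hab fun _ ht =>
    norm_gibbsState_imagTimeEvolve_mul_le hH (h0.trans ht.1) (ht.2.trans hb) (H * A - A * H) B

end Lipschitz

end Literature.MathematicalPhysics.QuantumLattice

namespace Literature.MathematicalPhysics.QuantumLattice

/-! ### The Hubbard model -/

section Hubbard

open Literature.Probability.LatticeModels

/-- **BGM's Schwinger function is bounded by one**: for the 2D Hubbard torus,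
`|S^{β,L}(𝐱,σ,-;𝐲,σ',+)| ≤ 1` whenever `|x₀ - y₀| ≤ β`, for all `U, μ, L` (`‖c‖, ‖c†‖ ≤ 1`).
BGM 2006 §1.2. [folklore] -/
theorem norm_hubbardSchwingerTwoPoint_le_one (β U μ : ℝ) (L : ℕ) {x₀ y₀ : ℝ} (h : |x₀ - y₀| ≤ β)
    (x : Site 2) (σ : Fin 2) (y : Site 2) (σ' : Fin 2) :
    ‖hubbardSchwingerTwoPoint β U μ L x₀ x σ y₀ y σ'‖ ≤ 1 := by
  by_cases hL : L = 0
  · simp [hubbardSchwingerTwoPoint, hL]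
  · haveI : NeZero L := ⟨hL⟩
    haveI : Nonempty (Finset (Orb (FermionTorus 2 L))) := ⟨∅⟩
    rw [hubbardSchwingerTwoPoint_eq, hubbardTorusWith]
    refine (norm_schwingerTwoPoint_le (isHermitian_hamiltonianWith _ 1 U μ) _ _ h).trans ?_
    have ha := norm_annihilation_le_one (ι := Orb (FermionTorus 2 L))
      (orb (FermionTorus.ofTorusSite (Torus.proj L x)) σ)
    have hc := norm_creation_le_one (ι := Orb (FermionTorus 2 L))
      (orb (FermionTorus.ofTorusSite (Torus.proj L y)) σ')
    calc _ ≤ 1 * 1 := mul_le_mul ha hc (norm_nonneg _) zero_le_one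
      _ = 1 := one_mul 1

/-- **Subsequential thermodynamic limits of the Schwinger function always exist** (Bolzano–
Weierstrass): for all parameters and times with `|x₀ - y₀| ≤ β` there are `S` with `|S| ≤ 1` and a
strictly increasing sequence of volumes along which `S^{β,L}(𝐱,σ,-;𝐲,σ',+) → S`. BGM's Theorem 1.1
asserts (in its regime, for the Fourier transform) the uniqueness of the limit point along all
volumes; that is NOT claimed here. [cite: BenfattoGiulianiMastropietro2006, Thm. 1.1 ("in the limit L = ∞")] -/
theorem exists_tendsto_subseq_hubbardSchwingerTwoPoint (β U μ : ℝ) {x₀ y₀ : ℝ} (h : |x₀ - y₀| ≤ β)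
    (x : Site 2) (σ : Fin 2) (y : Site 2) (σ' : Fin 2) :
    ∃ S : ℂ, ‖S‖ ≤ 1 ∧ ∃ φ : ℕ → ℕ, StrictMono φ ∧
      Filter.Tendsto (fun n => hubbardSchwingerTwoPoint β U μ (φ n) x₀ x σ y₀ y σ') Filter.atTop (nhds S) := by
  obtain ⟨S, hS, φ, hφ, hlim⟩ := tendsto_subseq_of_bounded
    (Metric.isBounded_closedBall (x := (0 : ℂ)) (r := 1))
    (x := fun L : ℕ => hubbardSchwingerTwoPoint β U μ L x₀ x σ y₀ y σ')
    (fun L => mem_closedBall_zero_iff.2 (norm_hubbardSchwingerTwoPoint_le_one β U μ L h x σ y σ'))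
  refine ⟨S, ?_, φ, hφ, hlim⟩
  rw [Metric.closure_closedBall, mem_closedBall_zero_iff] at hS
  exact hS

end Hubbard

end Literature.MathematicalPhysics.QuantumLattice
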